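import Summits.QuantumFields.BalabanUV.Beta.GAN24.WSlotFirstDiff

/-!
# `BalabanUV.Beta.GAN24.WSlotFirstDiffBorder` — binder row G-an2-4 / (CONV-C), W-slot road «W3», ROW W3-F4d SHAPE HALF AT A GENERIC BORDER TABLE
# (row owner b2b-balaban-gan24-p1, gen 6; referee r53 (w9) ROOT ALIGNMENT: the `WSlotFirstDiff` §2 texts with an1's base border `vh₂S d Lc` replaced by ANY
# `LocStencil₂` border table `B` — in particular the ROOTED border `vh₂SAt (toSite r) Lc` of `MixedJetTablesPlug.JsBalAn1` / `JsBalAn1Ctr`, road BF-x's literal)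

NOT IN PRINT; OUR PROOF ATTEMPT ([folklore] bookkeeping, the proofs of leaf-07's `WSlotFirstDiff.shape_pair` / `hD0_shape` / `hD0_pair` VERBATIM with the
border hypothesis `hB : ∃ C δ, 0 < δ ∧ LocStencil₂ B C δ` taken as a binder instead of being discharged by `T2SlotUnits.locStencil₂_vh₂S`; at
`B := vh₂S d Lc` they ARE those theorems, at `B := vh₂SAt (toSite r) Lc` the binder is `MixedJetTablesPlug.hB_an1 hLc hr`).  HONEST FRAMING (cell contract,
verbatim): «discharging `BetaPertH` makes Bałaban's UV stability UNCONDITIONAL — a real constructive-QFT result; it is NOT the continuum limit and NOT the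
Clay problem.»  HONEST DEPENDENCY (verbatim): «continuum YM on T⁴ ⇐ BetaPertH ∧ nine spine estimates (0/9 proved); BetaPertH ⇐ (D1) ∧ (D4) ∧ CAP+tail;
G-an2-4 gates asym, D1 and NE2/3/4.»  WHY: the W-pair of asym1's wall is a tree theorem for the PINNED family at the BASE border only
(`WSlotT2Tables.hW_hWall_three_an1_pinned`); the β-lead's literal `JsBalAn1Ctr` (road BF-x) and ref2's (w9) want the SAME chain at the rooted border —
this is its first row (the campaign's cost sheet: `HOME/b2b-balaban-gan24-p1/SLOT-COVERAGE.md` row (B)).  Discharges NOTHING by itself; 0 `def`, 0 cite,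
0 `def … : Prop`, 0 sorry; NOT «W-slot closed», NEVER «G-an2-4 closed», NOT (CONV-C) for `G_k/H_k`; NOT BetaPertH, NOT continuum, NOT Clay.
-/

noncomputable section

open Literature.MathematicalPhysics.QuantumFieldTheory
open Literature.MathematicalPhysics.QuantumFieldTheory.Balaban1983to89
open Literature.MathematicalPhysics.QuantumFieldTheory.Balaban1983to89.Beta
open ExpKernelCalculus (MKer)
open OneStepResolventKernel (Fib)
open BalabanCompositeJets (LocStencil₂)
open SecondOrderResponse (LocStencilFM)
open BalabanStepW2 (T2Of T2Of_loc locStencil₂_smul' locStencil₂_add')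
open Summit.QuantumFields.BalabanUV.Beta.SecondOrderUnits (unitS₂)
open Summit.QuantumFields.BalabanUV.Beta.GAN24.CombesThomas (sfStep smStep)
open Summit.QuantumFields.BalabanUV.Beta.GAN24.WSlotFirstDiff (locStencil₂_unitS₂)

namespace Summit.QuantumFields.BalabanUV.Beta.GAN24.WSlotFirstDiffBorder

variable {d : ℕ} {Lc : ℕ} [NeZero Lc]

/-- [folklore] **MEMBERS `0` AND `1` OF THE NORMALISED FAMILY AT ONE COMMON POSITIVE RATE, GENERIC BORDER `B`** (`WSlotFirstDiff.shape_pair` with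
the border shape `hB` as a binder). -/
theorem shape_pair (hLc : 1 ≤ Lc) (cE cVH cΛ cE₂ cB : ℝ) (Tc : Fin 4 → Fin 4 → Fin 4 → Fin 4 → ℝ)
    {B : Fin (d + 1) → (Fin (d + 1) → ℤ) → Fin (d + 1) → (Fin (d + 1) → ℤ) → MKer (d + 1) (Fib d)}
    (hB : ∃ C δ : ℝ, 0 < δ ∧ LocStencil₂ B C δ)
    {mixFF : Fin (d + 1) → (Fin (d + 1) → ℤ) → Fin (d + 1) → (Fin (d + 1) → ℤ) → MKer (d + 1) (Fib d)}
    (hmix : ∃ C δ : ℝ, 0 < δ ∧ LocStencilFM Lc mixFF C δ) :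
    ∃ C₀ C₁ δ₀ : ℝ, 0 < δ₀ ∧ 0 ≤ C₀ ∧ 0 ≤ C₁ ∧
      LocStencil₂ (unitS₂ (sfStep Lc 0) (smStep d Lc 0) (T2Of d Lc cE cVH cΛ cE₂ cB Tc B mixFF 0)) C₀ δ₀ ∧
      LocStencil₂ (unitS₂ (sfStep Lc 1) (smStep d Lc 1) (T2Of d Lc cE cVH cΛ cE₂ cB Tc B mixFF 1)) C₁ δ₀ := by
  obtain ⟨A₀, δa, hδa, h₀⟩ := T2Of_loc hLc cE cVH cΛ cE₂ cB Tc hB hmix 0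
  obtain ⟨A₁, δb, hδb, h₁⟩ := T2Of_loc hLc cE cVH cΛ cE₂ cB Tc hB hmix 1
  have u0 := locStencil₂_unitS₂ (sfStep Lc 0) (smStep d Lc 0) h₀
  have u1 := locStencil₂_unitS₂ (sfStep Lc 1) (smStep d Lc 1) h₁
  exact ⟨_, _, min δa δb, lt_min hδa hδb, u0.nonneg, u1.nonneg, u0.mono (min_le_left _ _), u1.mono (min_le_right _ _)⟩

/-- [folklore] **ROW W3-F4d, SHAPE HALF `hD0`, GENERIC BORDER `B`**: the first difference `T♮₁ − T♮₀` of the normalised family is a `LocStencil₂` family at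
every rate `δ ≤ δ₀` (`WSlotFirstDiff.hD0_shape` with `hB` as a binder). -/
theorem hD0_shape (hLc : 1 ≤ Lc) (cE cVH cΛ cE₂ cB : ℝ) (Tc : Fin 4 → Fin 4 → Fin 4 → Fin 4 → ℝ)
    {B : Fin (d + 1) → (Fin (d + 1) → ℤ) → Fin (d + 1) → (Fin (d + 1) → ℤ) → MKer (d + 1) (Fib d)}
    (hB : ∃ C δ : ℝ, 0 < δ ∧ LocStencil₂ B C δ)
    {mixFF : Fin (d + 1) → (Fin (d + 1) → ℤ) → Fin (d + 1) → (Fin (d + 1) → ℤ) → MKer (d + 1) (Fib d)}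
    (hmix : ∃ C δ : ℝ, 0 < δ ∧ LocStencilFM Lc mixFF C δ) :
    ∃ C₀ δ₀ : ℝ, 0 < δ₀ ∧ 0 ≤ C₀ ∧ ∀ δ : ℝ, δ ≤ δ₀ →
      LocStencil₂ (fun κ u κ' u' =>
        unitS₂ (sfStep Lc 1) (smStep d Lc 1) (T2Of d Lc cE cVH cΛ cE₂ cB Tc B mixFF 1) κ u κ' u'
          - unitS₂ (sfStep Lc 0) (smStep d Lc 0) (T2Of d Lc cE cVH cΛ cE₂ cB Tc B mixFF 0) κ u κ' u') C₀ δ := by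
  obtain ⟨C₀, C₁, δ₀, hδ₀, hC₀, hC₁, h₀, h₁⟩ := shape_pair hLc cE cVH cΛ cE₂ cB Tc hB hmix
  refine ⟨C₁ + |(-1 : ℝ)| * C₀, δ₀, hδ₀, by positivity, fun δ hδ => ?_⟩
  have e : (fun κ u κ' u' =>
        unitS₂ (sfStep Lc 1) (smStep d Lc 1) (T2Of d Lc cE cVH cΛ cE₂ cB Tc B mixFF 1) κ u κ' u'
          - unitS₂ (sfStep Lc 0) (smStep d Lc 0) (T2Of d Lc cE cVH cΛ cE₂ cB Tc B mixFF 0) κ u κ' u')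
      = fun κ u κ' u' =>
        unitS₂ (sfStep Lc 1) (smStep d Lc 1) (T2Of d Lc cE cVH cΛ cE₂ cB Tc B mixFF 1) κ u κ' u'
          + (-1 : ℝ) • unitS₂ (sfStep Lc 0) (smStep d Lc 0) (T2Of d Lc cE cVH cΛ cE₂ cB Tc B mixFF 0) κ u κ' u' := by
    funext κ u κ' u'
    rw [neg_one_smul, sub_eq_add_neg]
  rw [e]
  exact locStencil₂_add' (h₁.mono hδ) (locStencil₂_smul' (-1) (h₀.mono hδ))

/-- [folklore] **ROW W3-F4d, the END's `h0` PAIR at `mom := fun _ ↦ 0`, GENERIC BORDER `B`** (`WSlotFirstDiff.hD0_pair` with `hB` as a binder). -/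
theorem hD0_pair (hLc : 1 ≤ Lc) (cE cVH cΛ cE₂ cB : ℝ) (Tc : Fin 4 → Fin 4 → Fin 4 → Fin 4 → ℝ)
    {B : Fin (d + 1) → (Fin (d + 1) → ℤ) → Fin (d + 1) → (Fin (d + 1) → ℤ) → MKer (d + 1) (Fib d)}
    (hB : ∃ C δ : ℝ, 0 < δ ∧ LocStencil₂ B C δ)
    {mixFF : Fin (d + 1) → (Fin (d + 1) → ℤ) → Fin (d + 1) → (Fin (d + 1) → ℤ) → MKer (d + 1) (Fib d)}
    (hmix : ∃ C δ : ℝ, 0 < δ ∧ LocStencilFM Lc mixFF C δ) :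
    ∃ C₀ δ₀ : ℝ, 0 < δ₀ ∧ ∀ δ : ℝ, δ ≤ δ₀ →
      LocStencil₂ (fun κ u κ' u' =>
        unitS₂ (sfStep Lc 1) (smStep d Lc 1) (T2Of d Lc cE cVH cΛ cE₂ cB Tc B mixFF 1) κ u κ' u'
          - unitS₂ (sfStep Lc 0) (smStep d Lc 0) (T2Of d Lc cE cVH cΛ cE₂ cB Tc B mixFF 0) κ u κ' u') C₀ δ ∧
      (fun _ : Fin (d + 1) → (Fin (d + 1) → ℤ) → Fin (d + 1) → (Fin (d + 1) → ℤ) → MKer (d + 1) (Fib d) => (0 : ℝ))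
        (fun κ u κ' u' =>
          unitS₂ (sfStep Lc 1) (smStep d Lc 1) (T2Of d Lc cE cVH cΛ cE₂ cB Tc B mixFF 1) κ u κ' u'
            - unitS₂ (sfStep Lc 0) (smStep d Lc 0) (T2Of d Lc cE cVH cΛ cE₂ cB Tc B mixFF 0) κ u κ' u') ≤ C₀ := by
  obtain ⟨C₀, δ₀, hδ₀, hC₀, h⟩ := hD0_shape hLc cE cVH cΛ cE₂ cB Tc hB hmix
  exact ⟨C₀, δ₀, hδ₀, fun δ hδ => ⟨h δ hδ, hC₀⟩⟩

end Summit.QuantumFields.BalabanUV.Beta.GAN24.WSlotFirstDiffBorder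

end
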